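import Mathlib
import Literature.Analysis.FluidPDE.NSViscosityRescaling
import Literature.Analysis.FluidPDE.KNSSTypeIIHolds
import Literature.Analysis.FluidPDE.MollifiedSliceTools
import Summits.NavierStokesRegularity.NavierStokesRegularity.Theorems.PlaneEnergyCeilingBoundedPlanarEnergyRegularityZoomLimit
import Summits.NavierStokesRegularity.NavierStokesRegularity.Theorems.PlaneEnergyCeilingBoundedPlanarEnergyRegularityZoomOseenLimit
import Summits.NavierStokesRegularity.NavierStokesRegularity.Theorems.VorticityPacePaceZoomLimit
import Summits.NavierStokesRegularity.NavierStokesRegularity.Theorems.VorticityPaceTypeIImpliesPaceLimit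
import Summits.NavierStokesRegularity.NavierStokesRegularity.Theses.VorticityPace
import HarnessLib

/-!
# `VorticityPace.TypeIImpliesPace` — Type-I blow-up keeps the vorticity in pace with the speed²
  (item stmt-NavierStokesRegularity-7782)

**Statement.** `ν > 0`, `T > 0`, `(u, p)` a MAXIMAL classical solution on `ℝ³ × [0, T)`, Leray–Hopf
on `[0, T]` from a rapidly decaying datum, blowing up at the Type-I rate
(`IsTypeIBlowup u T`: `‖u(t)‖_∞ ≤ C/√(T − t)` near `T`). Then the PACE conclusion holds: for some
`θ₀ > 0` and times `t` arbitrarily close to `T` there is a point `x` with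
`θ₀ ‖u(s, y)‖² ≤ ν ‖curl u(t)(x)‖` for all `s ∈ [0, t]`, `y`.

PROOF (by contradiction; KNSS 2009 §6).
1. If PACE fails, then for every `θ > 0` and all `t` near `T` the vorticity is small against the
   velocity record: `ν ‖curl u(t)(x)‖ < θ ‖u(s, y)‖²` for some `s ≤ t`, `y`.
2. Normalise `ν = 1` (`w(s) = ν⁻¹u(s/ν)`, `IsClassicalNSSolutionOn.viscosityRescale_set`); `w` is
   bounded on every `(0, T')`, `T' < νT` (Tao, `exists_forall_norm_le_of_tao2011`), NOT bounded on
   `(0, νT)` (`hasSmoothExtensionPast_of_bounded_holds`), with slices uniformly in `L²`; the Type-I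
   rate holds GLOBALLY as `‖w(τ)‖ √(νT − τ) ≤ C₂` (`TypeIImpliesPace.exists_typeI_envelope`).
3. The finite-energy velocity-record zoom (`BoundedPlanarEnergyRegularity.exists_zoom_limit_of_memLp_two`):
   rescaled solutions `V_j` bounded by `2` on `(A_j, 0]`, `A_j → −∞`, converging pointwise on
   `(−∞, 0] × ℝ³` to a continuous `v` with `‖v(0, 0)‖ = 1`; the scales collapse (`c_j → 0`) and the
   record times accumulate at `νT`, so by step 1 the rescaled vorticities DIE OUT:
   `‖curl V_j(t)(y)‖ ≤ ε` eventually, for every `t < 0`, `y`, `ε > 0`; and the Type-I envelope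
   passes to `‖V_j(s)‖ √(−s) ≤ C₂`.
4. `TypeIImpliesPace.exists_const_of_zoom_curl_vanishing` (KNSS Lemma 6.1 with vorticity,
   curl-free/div-free Liouville, Remark 6.1): `v ≡ b` on the open slab; continuity at the apex
   gives `‖b‖ = ‖v(0,0)‖ = 1`, while the envelope gives `‖b‖ √(−s) ≤ C₂` for all `s < 0` — absurd.

HONEST FRAMING: an unconditional lemma about HYPOTHETICAL Type-I blow-up solutions (other route,
not a pub-ns-dss cell file); nothing here bears on the regularity problem itself.

References: Koch–Nadirashvili–Seregin–Šverák 2009, §6 (6.2)–(6.3), Lemma 6.1, Remark 6.1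
(arXiv:0709.3599 pp. 11–12); Seregin–Šverák 2009 §1. [KochNadirashviliSereginSverak2009]
[SereginSverak2009]
-/

noncomputable section

set_option linter.dupNamespace false

namespace Summit.NavierStokesRegularity.NavierStokesRegularity.Theorems

open MeasureTheory Set Function Filter Topology TopologicalSpace Metric
open scoped NNReal ENNReal ContDiff
open Literature.Analysis Literature.Analysis.FluidPDE

open TypeIImpliesPace PaceZoom in
/-- **`VorticityPace.TypeIImpliesPace`** (item stmt-NavierStokesRegularity-7782, module docstring):
a maximal classical Leray–Hopf solution from a rapidly decaying datum which blows up at the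
Type-I rate satisfies the PACE conclusion. [cite: KochNadirashviliSereginSverak2009, §6 (6.2)–(6.3), Lemma 6.1, Remark 6.1 (arXiv:0709.3599 pp. 11–12)] -/
theorem vorticityPace_typeIImpliesPace_proof : Theses.VorticityPace.TypeIImpliesPace := by
  intro ν T hν hT u p hmax hLH hdec hI
  by_contra hneg
  have hcl : IsClassicalNSSolutionOn (Ico 0 T) ν 0 u p := hmax.1
  have hne : ¬ HasSmoothExtensionPast ν 0 u T := hmax.2
  have hν' : 0 < ν⁻¹ := inv_pos.2 hν
  have hνT : 0 < ν * T := mul_pos hν hT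
  have hu₀2 : MemLp (u 0) 2 volume := hLH.memLp 0 ⟨le_rfl, hT.le⟩
  -- the negated PACE conclusion: the vorticity is eventually small against the velocity record
  have hsmall : ∀ θ : ℝ, 0 < θ → ∃ t₁ ∈ Ico (0 : ℝ) T, ∀ t ∈ Ico t₁ T,
      ∀ x : EuclideanSpace ℝ (Fin 3), ∃ s ∈ Icc (0 : ℝ) t, ∃ y : EuclideanSpace ℝ (Fin 3),
        ν * ‖curl (u t) x‖ < θ * ‖u s y‖ ^ 2 := by
    intro θ hθ
    by_contra h'
    push Not at h'
    exact hneg ⟨θ, hθ, h'⟩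
  -- the global Type-I envelope
  obtain ⟨C₁, hC₁0, hC₁⟩ := exists_typeI_envelope hν hT hcl hLH hdec hI
  obtain ⟨C₀, hC₀⟩ := hdec 0 0
  have hC₀' : ∀ x, ‖u 0 x‖ ≤ C₀ := fun x => by
    have h1 := hC₀ x
    rwa [pow_zero, one_mul, norm_iteratedFDeriv_zero] at h1
  -- adapted from `BoundedPlanarEnergyRegularity.stub_planarEnergyZoom`
  -- (Theorems/PlaneEnergyCeilingBoundedPlanarEnergyRegularityStubPlanarEnergyZoom.lean), Steps 1–2
  -- ### Step 1: normalise the viscosity to `1`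
  set w : ℝ → EuclideanSpace ℝ (Fin 3) → EuclideanSpace ℝ (Fin 3) := timeRescale ν⁻¹ ν⁻¹ u
    with hwdef
  set q : ℝ → EuclideanSpace ℝ (Fin 3) → ℝ := timeRescale ν⁻¹ (ν⁻¹ ^ 2) p with hqdef
  have hmaps : MapsTo (fun s => ν⁻¹ * s) (Ioo 0 (ν * T)) (Ioo 0 T) := fun s hs =>
    (inv_mul_mem_Ioo_iff hν).2 hs
  have hclw : IsClassicalNSSolutionOn (Ioo 0 (ν * T)) 1 0 w q := by
    have h1 := (hcl.mono Ioo_subset_Ico_self (uniqueDiffOn_Ioo 0 T)).viscosityRescale_set hν.ne'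
      hmaps (uniqueDiffOn_Ioo 0 (ν * T))
    simpa only [timeRescale_zero_force] using h1
  have hw_apply : ∀ s x, w s x = ν⁻¹ • u (ν⁻¹ * s) x := fun s x => rfl
  have hw_norm : ∀ s x, ‖w s x‖ = ν⁻¹ * ‖u (ν⁻¹ * s) x‖ := fun s x => by
    rw [hw_apply, norm_smul, Real.norm_eq_abs, abs_of_pos hν']
  -- ### Step 2: bounded before `νT`, not bounded up to `νT`, slices uniformly in `L²`
  have hbddw : ∀ T' < ν * T, ∃ M₁ : ℝ, ∀ s ∈ Ioo 0 T', ∀ x, ‖w s x‖ ≤ M₁ := by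
    intro T' hT'
    rcases le_or_gt T' 0 with hT'0 | hT'0
    · exact ⟨0, fun s hs _ => absurd (hs.1.trans hs.2) (not_lt.2 hT'0)⟩
    · have hT₁ : ν⁻¹ * T' ∈ Ioo 0 T := (inv_mul_mem_Ioo_iff hν).2 ⟨hT'0, hT'⟩
      obtain ⟨M₁, hM₁⟩ := exists_forall_norm_le_of_tao2011 tao2011_hasBoundedSobolevNormsOn_holds hν
        hcl hLH hdec (ν⁻¹ * T') hT₁
      refine ⟨ν⁻¹ * M₁, fun s hs x => ?_⟩
      rw [hw_norm]
      refine mul_le_mul_of_nonneg_left (hM₁ _ ⟨?_, ?_⟩ x) hν'.le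
      · exact mul_nonneg hν'.le hs.1.le
      · exact mul_le_mul_of_nonneg_left hs.2.le hν'.le
  have hunbw : ¬ ∃ M₁ : ℝ, ∀ s ∈ Ioo 0 (ν * T), ∀ x, ‖w s x‖ ≤ M₁ := by
    rintro ⟨M₁, hM₁⟩
    apply hne
    refine hasSmoothExtensionPast_of_bounded_holds hν hT hcl hLH ⟨max (ν * M₁) C₀, fun t ht x => ?_⟩
    rcases ht.1.eq_or_lt with h0 | h0
    · rw [← h0]
      exact (hC₀' x).trans (le_max_right _ _)
    · have hs : ν * t ∈ Ioo 0 (ν * T) := ⟨mul_pos hν h0, mul_lt_mul_of_pos_left ht.2 hν⟩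
      have h1 := hM₁ (ν * t) hs x
      rw [hw_norm, ← mul_assoc, inv_mul_cancel₀ hν.ne', one_mul] at h1
      have h2 : ‖u t x‖ ≤ ν * M₁ := by
        rw [inv_mul_le_iff₀ hν] at h1
        exact h1
      exact h2.trans (le_max_left _ _)
  have hmem_u : ∀ s ∈ Ioo 0 (ν * T), ν⁻¹ * s ∈ Icc 0 T := fun s hs =>
    ⟨(hmaps hs).1.le, (hmaps hs).2.le⟩
  have hL2w : ∀ s ∈ Ioo 0 (ν * T), MemLp (w s) 2 volume := fun s hs =>
    (hLH.memLp _ (hmem_u s hs)).const_smul ν⁻¹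
  set K₀ : ℝ≥0∞ := ENNReal.ofReal ν⁻¹ * eLpNorm (u 0) 2 volume with hK₀
  have hK₀top : K₀ ≠ ⊤ := ENNReal.mul_ne_top ENNReal.ofReal_ne_top hu₀2.eLpNorm_ne_top
  have hK₀b : ∀ s ∈ Ioo 0 (ν * T), eLpNorm (w s) 2 volume ≤ K₀ := by
    intro s hs
    have h1 : w s = ν⁻¹ • u (ν⁻¹ * s) := rfl
    rw [h1, eLpNorm_const_smul, Real.enorm_eq_ofReal hν'.le, hK₀]
    gcongr
    exact hLH.eLpNorm_le_eLpNorm_datum hν.le hu₀2 (hmem_u s hs)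
  set T₁ : ℝ := ν * T with hT₁
  have hT₁pos : 0 < T₁ := hνT
  -- the negated PACE conclusion and the Type-I envelope in the normalised variables
  have hsmallW : ∀ θ : ℝ, 0 < θ → ∃ τ₁ : ℝ, τ₁ < T₁ ∧ ∀ τ ∈ Ico τ₁ T₁, 0 < τ →
      ∀ x : EuclideanSpace ℝ (Fin 3), ∃ σ ∈ Icc (0 : ℝ) τ, ∃ y : EuclideanSpace ℝ (Fin 3),
        ‖curl (w τ) x‖ < θ * ‖w σ y‖ ^ 2 := by
    intro θ hθ
    obtain ⟨t₁, ht₁, h⟩ := hsmall θ hθ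
    refine ⟨ν * t₁, mul_lt_mul_of_pos_left ht₁.2 hν, fun τ hτ hτ0 x => ?_⟩
    have htmem : ν⁻¹ * τ ∈ Ico t₁ T := by
      refine ⟨?_, ((inv_mul_mem_Ioo_iff hν).2 ⟨hτ0, hτ.2⟩).2⟩
      calc t₁ = ν⁻¹ * (ν * t₁) := by rw [← mul_assoc, inv_mul_cancel₀ hν.ne', one_mul]
        _ ≤ ν⁻¹ * τ := mul_le_mul_of_nonneg_left hτ.1 hν'.le
    obtain ⟨s, hs, y, hxy⟩ := h (ν⁻¹ * τ) htmem x
    refine ⟨ν * s, ⟨mul_nonneg hν.le hs.1, ?_⟩, y, ?_⟩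
    · calc ν * s ≤ ν * (ν⁻¹ * τ) := mul_le_mul_of_nonneg_left hs.2 hν.le
        _ = τ := by rw [← mul_assoc, mul_inv_cancel₀ hν.ne', one_mul]
    · have hdiff : DifferentiableAt ℝ (u (ν⁻¹ * τ)) x :=
        ((hcl.contDiff_velocity ⟨ht₁.1.trans htmem.1, htmem.2⟩).differentiable
          (by simp)).differentiableAt
      have hcurl : curl (w τ) x = ν⁻¹ • curl (u (ν⁻¹ * τ)) x := by
        rw [show w τ = fun z => ν⁻¹ • u (ν⁻¹ * τ) z from rfl, curl_eq_curlCLM, curl_eq_curlCLM,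
          fderiv_fun_const_smul hdiff, map_smul]
      rw [hcurl, norm_smul, Real.norm_eq_abs, abs_of_pos hν', hw_norm, ← mul_assoc,
        inv_mul_cancel₀ hν.ne', one_mul, mul_pow]
      have h2 : θ * (ν⁻¹ ^ 2 * ‖u s y‖ ^ 2) = ν⁻¹ * (ν⁻¹ * (θ * ‖u s y‖ ^ 2)) := by ring
      rw [h2]
      refine mul_lt_mul_of_pos_left ?_ hν'
      calc ‖curl (u (ν⁻¹ * τ)) x‖ = ν⁻¹ * (ν * ‖curl (u (ν⁻¹ * τ)) x‖) := by
            rw [← mul_assoc, inv_mul_cancel₀ hν.ne', one_mul]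
        _ < ν⁻¹ * (θ * ‖u s y‖ ^ 2) := mul_lt_mul_of_pos_left hxy hν'
  have hIw : ∀ τ ∈ Ioo 0 T₁, ∀ y, ‖w τ y‖ * Real.sqrt (T₁ - τ) ≤ C₁ * Real.sqrt ν⁻¹ := by
    intro τ hτ y
    have ht : ν⁻¹ * τ ∈ Ico 0 T := ⟨(hmaps hτ).1.le, (hmaps hτ).2⟩
    have h1 := hC₁ _ ht y
    have hsq : Real.sqrt (T₁ - τ) = Real.sqrt ν * Real.sqrt (T - ν⁻¹ * τ) := by
      rw [← Real.sqrt_mul hν.le]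
      congr 1
      rw [hT₁]; field_simp
    rw [hw_norm, hsq]
    have hνs : Real.sqrt ν⁻¹ * Real.sqrt ν = 1 := by
      rw [← Real.sqrt_mul hν'.le, inv_mul_cancel₀ hν.ne', Real.sqrt_one]
    calc ν⁻¹ * ‖u (ν⁻¹ * τ) y‖ * (Real.sqrt ν * Real.sqrt (T - ν⁻¹ * τ))
        = (Real.sqrt ν⁻¹ * Real.sqrt ν⁻¹) * Real.sqrt ν *
            (‖u (ν⁻¹ * τ) y‖ * Real.sqrt (T - ν⁻¹ * τ)) := by
          rw [Real.mul_self_sqrt hν'.le]; ring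
      _ = Real.sqrt ν⁻¹ * (‖u (ν⁻¹ * τ) y‖ * Real.sqrt (T - ν⁻¹ * τ)) := by
          rw [mul_assoc (Real.sqrt ν⁻¹), hνs, mul_one]
      _ ≤ Real.sqrt ν⁻¹ * C₁ := mul_le_mul_of_nonneg_left h1 (Real.sqrt_nonneg _)
      _ = C₁ * Real.sqrt ν⁻¹ := mul_comm _ _
  set C₂ : ℝ := C₁ * Real.sqrt ν⁻¹ with hC₂
  -- ### Step 3: the finite-energy velocity-record zoom and its limit
  obtain ⟨v, tn, xn, c, htn, hcpos, hAtend, hVbd, hVlim, hvcont, -, hv1, -, -⟩ :=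
    BoundedPlanarEnergyRegularity.exists_zoom_limit_of_memLp_two T₁ w q hT₁pos hclw hbddw hunbw hL2w
  set A : ℕ → ℝ := fun j => -(tn j / c j ^ 2) with hAdef
  set B : ℕ → ℝ := fun j => (T₁ - tn j) / c j ^ 2 with hBdef
  obtain ⟨V, hV⟩ : ∃ V : ℕ → ℝ → EuclideanSpace ℝ (Fin 3) → EuclideanSpace ℝ (Fin 3),
      ∀ j, V j = c j • stPull (c j ^ 2) (c j) (tn j) (xn j) w := ⟨_, fun _ => rfl⟩
  obtain ⟨P, hP⟩ : ∃ P : ℕ → ℝ → EuclideanSpace ℝ (Fin 3) → ℝ,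
      ∀ j, P j = c j ^ 2 • stPull (c j ^ 2) (c j) (tn j) (xn j) q := ⟨_, fun _ => rfl⟩
  have hVcl : ∀ j, IsClassicalNSSolutionOn (Ioo (A j) (B j)) 1 0 (V j) (P j) := fun j => by
    rw [hV j, hP j]
    exact (hclw.nsRescale_translate_zero (hcpos j) (tn j) (xn j)).mono
      (fun _ hs => zoom_time_mem (hcpos j).ne' hs) (uniqueDiffOn_Ioo _ _)
  have hBpos : ∀ j, 0 < B j := fun j =>
    div_pos (by linarith [(htn j).2]) (pow_pos (hcpos j) 2)
  have hVapply : ∀ j s y, V j s y = c j • w (tn j + c j ^ 2 * s) (xn j + c j • y) :=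
    fun j s y => by rw [hV j, smul_stPull_apply]
  have hVnorm : ∀ j s y, ‖V j s y‖ = c j * ‖w (tn j + c j ^ 2 * s) (xn j + c j • y)‖ :=
    fun j s y => by rw [hVapply, norm_smul, Real.norm_eq_abs, abs_of_pos (hcpos j)]
  have hVbd2 : ∀ j, ∀ s ∈ Ioc (A j) 0, ∀ y, ‖V j s y‖ ≤ 2 := fun j s hs y => by
    rw [hV j]; exact hVbd j s hs y
  have hVlim' : ∀ t ≤ 0, ∀ x, Tendsto (fun j => V j t x) atTop (𝓝 (v t x)) := fun t ht x => by
    simp only [hV]; exact hVlim t ht x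
  -- the physical bound `‖w σ z‖ ≤ 2 / c j` on `(0, tn j]`
  have hwbd : ∀ j, ∀ σ ∈ Ioc (0 : ℝ) (tn j), ∀ z, ‖w σ z‖ ≤ 2 / c j := by
    intro j σ hσ z
    have hc2 : 0 < c j ^ 2 := pow_pos (hcpos j) 2
    set s : ℝ := (σ - tn j) / c j ^ 2 with hsdef
    have hs : s ∈ Ioc (A j) 0 := by
      refine ⟨?_, div_nonpos_of_nonpos_of_nonneg (by linarith [hσ.2]) hc2.le⟩
      show -(tn j / c j ^ 2) < (σ - tn j) / c j ^ 2
      rw [← neg_div]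
      exact div_lt_div_of_pos_right (by linarith [hσ.1]) hc2
    have h1 := hVbd2 j s hs ((c j)⁻¹ • (z - xn j))
    have hts : tn j + c j ^ 2 * s = σ := by
      rw [hsdef, mul_div_assoc', mul_div_cancel_left₀ _ hc2.ne']; ring
    rw [hVnorm, smul_smul, mul_inv_cancel₀ (hcpos j).ne', one_smul, add_sub_cancel, hts] at h1
    rwa [le_div_iff₀ (hcpos j), mul_comm]
  -- uniform `L²` bound of the rescaled slices on `(A j, 0]`
  have hVK : ∀ j, ∃ K : ℝ≥0∞, K ≠ ⊤ ∧ ∀ s ∈ Ioc (A j) 0, eLpNorm (V j s) 2 volume ≤ K := by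
    intro j
    refine ⟨ENNReal.ofReal (c j) * (ENNReal.ofReal ((c j ^ 3)⁻¹) ^ (1 / (2 : ℝ≥0∞)).toReal * K₀),
      ENNReal.mul_ne_top ENNReal.ofReal_ne_top (ENNReal.mul_ne_top
        (ENNReal.rpow_ne_top_of_nonneg (by positivity) ENNReal.ofReal_ne_top) hK₀top),
      fun s hs => ?_⟩
    have hmem : tn j + c j ^ 2 * s ∈ Ioo 0 T₁ := by
      have h1 := zoom_time_mem_Ioc (t₀ := tn j) (hcpos j).ne' hs
      exact ⟨h1.1, h1.2.trans_lt (htn j).2⟩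
    rw [show V j s = fun y => c j • w (tn j + c j ^ 2 * s) (xn j + c j • y) from
      funext (hVapply j s), BoundedPlanarEnergyRegularity.eLpNorm_two_zoom_slice _ _ (hcpos j)]
    gcongr
    exact hK₀b _ hmem
  -- ### Step 4: the scales collapse (`c j → 0`) and the record times accumulate at `T₁`
  have hc0 : Tendsto c atTop (𝓝 0) := by
    have h1 : Tendsto (fun j => tn j / c j ^ 2) atTop atTop := by
      have h := tendsto_neg_atBot_atTop.comp hAtend
      refine h.congr fun j => ?_
      show -(-(tn j / c j ^ 2)) = tn j / c j ^ 2
      exact neg_neg _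
    refine Metric.tendsto_atTop.2 fun ε hε => ?_
    obtain ⟨N, hN⟩ := tendsto_atTop_atTop.1 h1 (T₁ / ε ^ 2 + 1)
    refine ⟨N, fun j hj => ?_⟩
    have hε2 : 0 < ε ^ 2 := pow_pos hε 2
    have hc2 : 0 < c j ^ 2 := pow_pos (hcpos j) 2
    have h2 : T₁ / ε ^ 2 < tn j / c j ^ 2 := by linarith [hN j hj]
    have h3 : c j ^ 2 < ε ^ 2 := by
      rw [div_lt_div_iff₀ hε2 hc2] at h2
      nlinarith [(htn j).2, (htn j).1]
    rw [Real.dist_eq, sub_zero, abs_of_pos (hcpos j)]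
    nlinarith [hcpos j]
  have hVone : Tendsto (fun j => ‖V j 0 0‖) atTop (𝓝 1) := by
    rw [← hv1]; exact (hVlim' 0 le_rfl 0).norm
  have htnT : ∀ T' < T₁, ∀ᶠ j in atTop, T' < tn j := by
    intro T' hT'
    obtain ⟨M₁, hM₁⟩ := hbddw ((T' + T₁) / 2) (by linarith)
    have h1 : ∀ᶠ j in atTop, 1 / 2 < ‖V j 0 0‖ := hVone.eventually (lt_mem_nhds (by norm_num))
    have h2 : ∀ᶠ j in atTop, c j < 1 / (2 * (|M₁| + 1)) :=
      hc0.eventually (gt_mem_nhds (by positivity))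
    filter_upwards [h1, h2] with j hj1 hj2
    by_contra hle
    push Not at hle
    have hb : ‖w (tn j) (xn j)‖ ≤ |M₁| :=
      (hM₁ (tn j) ⟨(htn j).1, by linarith⟩ (xn j)).trans (le_abs_self _)
    have h3 : ‖V j 0 0‖ = c j * ‖w (tn j) (xn j)‖ := by
      rw [hVnorm, mul_zero, add_zero, smul_zero, add_zero]
    have h5 : c j * ‖w (tn j) (xn j)‖ < 1 / 2 :=
      calc c j * ‖w (tn j) (xn j)‖ ≤ c j * (|M₁| + 1) :=
            mul_le_mul_of_nonneg_left (by linarith [abs_nonneg M₁]) (hcpos j).le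
        _ < 1 / (2 * (|M₁| + 1)) * (|M₁| + 1) := mul_lt_mul_of_pos_right hj2 (by positivity)
        _ = 1 / 2 := by field_simp
    linarith
  -- ### Step 5: the rescaled vorticities die out
  have hcurl : ∀ t < 0, ∀ y, ∀ ε > (0 : ℝ), ∀ᶠ j in atTop, ‖curl (V j t) y‖ ≤ ε := by
    intro t ht y ε hε
    obtain ⟨τ₁, hτ₁, hθ⟩ := hsmallW (ε / 4) (by positivity)
    set τ₁' : ℝ := max τ₁ 0 with hτ₁'
    have hτ₁'T : τ₁' < T₁ := max_lt hτ₁ hT₁pos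
    have e1 : ∀ᶠ j in atTop, A j < t := hAtend.eventually (eventually_lt_atBot t)
    have e2 : ∀ᶠ j in atTop, (τ₁' + T₁) / 2 < tn j := htnT _ (by linarith)
    have e3 : ∀ᶠ j in atTop, c j ^ 2 * (-t) < (T₁ - τ₁') / 2 := by
      have h : Tendsto (fun j => c j ^ 2 * (-t)) atTop (𝓝 ((0 : ℝ) ^ 2 * (-t))) :=
        (hc0.pow 2).mul_const _
      rw [zero_pow two_ne_zero, zero_mul] at h
      exact h.eventually (gt_mem_nhds (by linarith))
    have e4 : ∀ᶠ j in atTop, c j * (ν⁻¹ * C₀) < 1 := by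
      have h : Tendsto (fun j => c j * (ν⁻¹ * C₀)) atTop (𝓝 ((0 : ℝ) * (ν⁻¹ * C₀))) :=
        hc0.mul_const _
      rw [zero_mul] at h
      exact h.eventually (gt_mem_nhds one_pos)
    filter_upwards [e1, e2, e3, e4] with j h1 h2 h3 h4
    have hc2 : 0 < c j ^ 2 := pow_pos (hcpos j) 2
    have hσ₀mem := zoom_time_mem_Ioc (t₀ := tn j) (hcpos j).ne' (show t ∈ Ioc (A j) 0 from ⟨h1, ht.le⟩)
    have hσ₀lt : tn j + c j ^ 2 * t < tn j := by nlinarith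
    have hσ₀ge : τ₁ ≤ tn j + c j ^ 2 * t := by
      have := le_max_left τ₁ 0
      nlinarith
    have hσ₀T : tn j + c j ^ 2 * t < T₁ := hσ₀lt.trans (htn j).2
    obtain ⟨σ, hσ, y', hlt⟩ := hθ (tn j + c j ^ 2 * t) ⟨hσ₀ge, hσ₀T⟩ hσ₀mem.1 (xn j + c j • y)
    -- the physical bound `‖w σ y'‖ ≤ 2 / c j` on `[0, tn j]`
    have hwσ : ‖w σ y'‖ ≤ 2 / c j := by
      rcases hσ.1.eq_or_lt with h0 | h0
      · rw [← h0, hw_norm, mul_zero]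
        calc ν⁻¹ * ‖u 0 y'‖ ≤ ν⁻¹ * C₀ := mul_le_mul_of_nonneg_left (hC₀' y') hν'.le
          _ ≤ 2 / c j := by rw [le_div_iff₀ (hcpos j)]; linarith
      · exact hwbd j σ ⟨h0, hσ.2.trans hσ₀lt.le⟩ y'
    have hd : Differentiable ℝ (w (tn j + c j ^ 2 * t)) :=
      (hclw.contDiff_velocity ⟨hσ₀mem.1, hσ₀T⟩).differentiable (by simp)
    rw [hV j, curl_zoom_slice hd, norm_smul, Real.norm_eq_abs,
      abs_of_pos (mul_pos (hcpos j) (hcpos j))]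
    have h5 : ‖curl (w (tn j + c j ^ 2 * t)) (xn j + c j • y)‖ ≤ ε / 4 * (2 / c j) ^ 2 :=
      calc ‖curl (w (tn j + c j ^ 2 * t)) (xn j + c j • y)‖ ≤ ε / 4 * ‖w σ y'‖ ^ 2 := hlt.le
        _ ≤ ε / 4 * (2 / c j) ^ 2 := by gcongr
    have hcj : c j ≠ 0 := (hcpos j).ne'
    calc c j * c j * ‖curl (w (tn j + c j ^ 2 * t)) (xn j + c j • y)‖
        ≤ c j * c j * (ε / 4 * (2 / c j) ^ 2) :=
          mul_le_mul_of_nonneg_left h5 (mul_pos (hcpos j) (hcpos j)).le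
      _ = ε := by field_simp; ring
  -- ### Step 6: the Type-I envelope of the rescaled solutions
  have hVI : ∀ j, ∀ s ∈ Ioo (A j) 0, ∀ y, ‖V j s y‖ * Real.sqrt (-s) ≤ C₂ := by
    intro j s hs y
    have hmem := zoom_time_mem_Ioc (t₀ := tn j) (hcpos j).ne' (show s ∈ Ioc (A j) 0 from ⟨hs.1, hs.2.le⟩)
    have hσT : tn j + c j ^ 2 * s ∈ Ioo 0 T₁ := ⟨hmem.1, hmem.2.trans_lt (htn j).2⟩
    have h1 := hIw _ hσT (xn j + c j • y)
    have hge : c j * Real.sqrt (-s) ≤ Real.sqrt (T₁ - (tn j + c j ^ 2 * s)) := by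
      have h2 : c j * Real.sqrt (-s) = Real.sqrt (c j ^ 2 * (-s)) := by
        rw [Real.sqrt_mul (sq_nonneg _), Real.sqrt_sq (hcpos j).le]
      rw [h2]
      exact Real.sqrt_le_sqrt (by nlinarith [(htn j).2, hs.2])
    rw [hVnorm]
    calc c j * ‖w (tn j + c j ^ 2 * s) (xn j + c j • y)‖ * Real.sqrt (-s)
        = ‖w (tn j + c j ^ 2 * s) (xn j + c j • y)‖ * (c j * Real.sqrt (-s)) := by ring
      _ ≤ ‖w (tn j + c j ^ 2 * s) (xn j + c j • y)‖ * Real.sqrt (T₁ - (tn j + c j ^ 2 * s)) :=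
          mul_le_mul_of_nonneg_left hge (norm_nonneg _)
      _ ≤ C₂ := h1
  -- ### Step 7: the limit is a uniform stream (tools lemma), of unit size, with Type-I decay
  obtain ⟨b, hb⟩ := exists_const_of_zoom_curl_vanishing hAtend hBpos hVcl hVbd2 hVK
    (fun t ht x => hVlim' t ht.le x) hcurl
  have hb0 : v 0 0 = b := by
    have hc : Continuous fun t : ℝ => v t 0 :=
      hvcont.comp (continuous_id.prodMk continuous_const)
    have h1 : Tendsto (fun t : ℝ => v t 0) (𝓝[<] 0) (𝓝 (v 0 0)) :=
      (hc.tendsto 0).mono_left nhdsWithin_le_nhds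
    have h2 : Tendsto (fun t : ℝ => v t 0) (𝓝[<] 0) (𝓝 b) :=
      tendsto_const_nhds.congr' (by
        filter_upwards [self_mem_nhdsWithin] with t ht using (hb t ht 0).symm)
    exact tendsto_nhds_unique h1 h2
  have hb1 : ‖b‖ = 1 := by rw [← hb0, hv1]
  have hbI : ∀ t < 0, ‖b‖ * Real.sqrt (-t) ≤ C₂ := by
    intro t ht
    have e1 : ∀ᶠ j in atTop, A j < t := hAtend.eventually (eventually_lt_atBot t)
    have hlim : Tendsto (fun j => ‖V j t 0‖ * Real.sqrt (-t)) atTop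
        (𝓝 (‖b‖ * Real.sqrt (-t))) := by
      rw [← hb t ht 0]
      exact ((hVlim' t ht.le 0).norm).mul_const _
    exact le_of_tendsto hlim (e1.mono fun j hj => hVI j t ⟨hj, ht⟩ 0)
  -- ### Step 8: contradiction at `t = −(C₂ + 1)²`
  have hC₂0 : 0 ≤ C₂ := by rw [hC₂]; positivity
  have h := hbI (-((C₂ + 1) ^ 2)) (by nlinarith)
  rw [hb1, one_mul, neg_neg, Real.sqrt_sq (by linarith)] at h
  linarith

end Summit.NavierStokesRegularity.NavierStokesRegularity.Theorems

end
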